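import Mathlib
import Literature.MathematicalPhysics.QuantumFieldTheory.Luscher2010.TrivializingMaps
import Literature.MathematicalPhysics.QuantumFieldTheory.Luscher2010.FlowActionSeries
import Literature.MathematicalPhysics.QuantumFieldTheory.Luscher2010.EulerStepProofs
import Summits.Ventures.LatticeQCDFlow.TrivializingMaps.Truncation
import Summits.Ventures.LatticeQCDFlow.TrivializingMaps.TruncationDefect
import HarnessLib

/-!
# Integration by parts on `SU(n)^E` and the zero modes of Lüscher's link Laplacian

HONEST FRAMING: exact (Metropolis-corrected) sampling algorithms for lattice gauge theory; figures of merit are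
autocorrelation/cost numbers at stated couplings and volumes; no continuum-physics claim.

Lüscher §4.2: the link Laplacian `Δ = -∑ ∂^a ∂^a` is symmetric and non-negative for the Haar scalar product,
`(φ, Δφ) = ∑ (∂^a φ, ∂^a φ) ≥ 0` (eq. (4.8) at `t = 0`), and "the function `φ(U) = 1` is the only zero mode".
This file proves these statements on the finite field manifold `SU(n)^E` with its Haar product probability
measure `trivialMeasure` (`D[U]`, eq. (2.1)), for smooth ambient representatives of the field functionals:
* `hasDerivAt_comp_linkCurve_at`: the link curve `s ↦ e^{sY} U(e)` has velocity `∂_{e,Y}` at every parameter;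
  `linkDeriv_mul_of_differentiableAt`: Leibniz rule for `∂_{e,Y}`;
* `hasDerivAt_integral_comp_linkCurve`, `integral_linkDeriv_eq_zero`: `∫ D[U] (∂_{e,Y} ψ)(U) = 0` for
  `Y ∈ 𝔰𝔲(n)` — left-invariance of `D[U]` under the one-parameter subgroup `U(e) ↦ e^{sY} U(e)` of the group
  `SU(n)^E`, differentiated under the integral sign at `s = 0`;
* `integral_mul_linkLap`: Green's identity `∫ D[U] φ Δχ = ∑_{e,a} ∫ D[U] ∂^a_e φ · ∂^a_e χ` (symmetry and
  positivity of `Δ`, eq. (4.8) at `t = 0`; `integral_mul_linkLap_self_nonneg`);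
* `linkDeriv_eq_zero_of_linkLap_eq_const`: if `Δφ` is constant on `SU(n)^E`, the constant is `0` and every
  `∂^a_e φ` vanishes on `SU(n)^E` (zero modes of `Δ` have vanishing gradient; Haar measure charges open sets).
The uniqueness of the flow-action series that Lüscher draws from this (§4.3) is the file `SeriesUniqueness`.
(Landing note, lean-1 gen-2: this is theory-1's `HaarIntegrationByParts.lean` of LANDING-2 row 16, landed under
the name `HaarByPartsZeroModes.lean` because the sibling file `TrivializingMaps/HaarIntegrationByParts.lean` of
the Jacobian-formula line (lean-2) reached the tree first; contents byte-identical, no shared declarations.)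

References: M. Lüscher, Trivializing maps, the Wilson flow and the HMC algorithm, CMP 293 (2010) 899
[Luscher2010Trivializing, arXiv:0907.5491], §2.1 eq. (2.1), §4.2 eqs. (4.5)–(4.10), App. A eqs. (A.3)–(A.5).
-/

namespace Summit.Ventures.LatticeQCDFlow.TrivializingMaps

open MeasureTheory
open Literature.MathematicalPhysics.QuantumFieldTheory
open Literature.MathematicalPhysics.QuantumFieldTheory.Luscher2010
open scoped Matrix Matrix.Norms.Frobenius ContDiff

variable {d L n : ℕ}

/-! ## §1. The link curve at a general parameter; Leibniz rule -/

section LinkCurve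

/-- Flow property of the link curve: `e^{hY} (e^{σY} W(e)) = e^{(h+σ)Y} W(e)`. [folklore] -/
theorem linkCurve_update_add (W : AmbConfig d L n) (e : Edge d L) (Y : Matrix (Fin n) (Fin n) ℂ)
    (σ h : ℝ) :
    Function.update (Function.update W e (NormedSpace.exp ((σ : ℂ) • Y) * W e)) e
        (NormedSpace.exp ((h : ℂ) • Y) *
          Function.update W e (NormedSpace.exp ((σ : ℂ) • Y) * W e) e) =
      Function.update W e (NormedSpace.exp (((h + σ : ℝ) : ℂ) • Y) * W e) := by
  have hc : Commute ((h : ℂ) • Y) ((σ : ℂ) • Y) := ((Commute.refl Y).smul_left _).smul_right _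
  rw [Function.update_idem, Function.update_self, ← mul_assoc, ← Matrix.exp_add_of_commute _ _ hc,
    ← add_smul, Complex.ofReal_add]

variable [NeZero L]

/-- **Velocity of the link curve at any parameter**: for differentiable `ψ`,
`d/ds ψ(e^{sY} W(e), …)|_{s=σ} = (∂_{e,Y} ψ)(e^{σY} W(e), …)` (the curve is an orbit of a one-parameter
group). [cite: Luscher2010Trivializing, App. A eq. (A.3)] -/
theorem hasDerivAt_comp_linkCurve_at {ψ : AmbConfig d L n → ℝ} (hψ : Differentiable ℝ ψ)
    (W : AmbConfig d L n) (e : Edge d L) (Y : Matrix (Fin n) (Fin n) ℂ) (σ : ℝ) :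
    HasDerivAt (fun s : ℝ => ψ (Function.update W e (NormedSpace.exp ((s : ℂ) • Y) * W e)))
      (linkDeriv e Y ψ (Function.update W e (NormedSpace.exp ((σ : ℂ) • Y) * W e))) σ := by
  have h0 : HasDerivAt
      (fun s : ℝ => ψ (Function.update W e (NormedSpace.exp (((s + σ : ℝ) : ℂ) • Y) * W e)))
      (linkDeriv e Y ψ (Function.update W e (NormedSpace.exp ((σ : ℂ) • Y) * W e))) 0 := by
    have h := hasDerivAt_comp_linkCurve
      (hψ (Function.update W e (NormedSpace.exp ((σ : ℂ) • Y) * W e))) e Y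
    rw [← linkDeriv_eq_fderiv (hψ _) e Y] at h
    simp only [linkCurve_update_add] at h
    exact h
  rw [show (0 : ℝ) = σ - σ from (sub_self σ).symm] at h0
  have h1 := HasDerivAt.comp_sub_const σ σ h0
  simp only [sub_add_cancel] at h1
  exact h1

/-- **Leibniz rule** for the link differential operator at a point of differentiability.
[cite: Luscher2010Trivializing, App. A eq. (A.3)] -/
theorem linkDeriv_mul_of_differentiableAt (e : Edge d L) (X : Matrix (Fin n) (Fin n) ℂ)
    {f g : AmbConfig d L n → ℝ} {W : AmbConfig d L n} (hf : DifferentiableAt ℝ f W)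
    (hg : DifferentiableAt ℝ g W) :
    linkDeriv e X (fun W' => f W' * g W') W = linkDeriv e X f W * g W + f W * linkDeriv e X g W := by
  rw [linkDeriv_eq_fderiv (f := fun W' => f W' * g W') (hf.mul hg) e X, linkDeriv_eq_fderiv hf,
    linkDeriv_eq_fderiv hg,
    show fderiv ℝ (fun W' => f W' * g W') W = f W • fderiv ℝ g W + g W • fderiv ℝ f W from fderiv_mul hf hg]
  show f W • fderiv ℝ g W (Pi.single e (X * W e)) + g W • fderiv ℝ f W (Pi.single e (X * W e)) = _
  simp only [smul_eq_mul]
  ring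

/-- Subtraction rule for `∂_{e,X}` at a point of differentiability. [folklore] -/
theorem linkDeriv_sub_of_differentiableAt (e : Edge d L) (X : Matrix (Fin n) (Fin n) ℂ)
    {f g : AmbConfig d L n → ℝ} {W : AmbConfig d L n} (hf : DifferentiableAt ℝ f W)
    (hg : DifferentiableAt ℝ g W) :
    linkDeriv e X (fun W' => f W' - g W') W = linkDeriv e X f W - linkDeriv e X g W := by
  have h1 : (fun W' => f W' - g W') = fun W' => f W' + (-1) * g W' := by funext W'; ring
  rw [h1, linkDeriv_add_of_differentiableAt e X hf (hg.const_mul (-1)), linkDeriv_const_mul']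
  ring

/-- Subtraction rule for `Δ` on smooth functions. [folklore] -/
theorem linkLap_sub_of_contDiff (B : SuBasis n) {f g : AmbConfig d L n → ℝ} (hf : ContDiff ℝ ∞ f)
    (hg : ContDiff ℝ ∞ g) (W : AmbConfig d L n) :
    linkLap B (fun W' => f W' - g W') W = linkLap B f W - linkLap B g W := by
  have h1 : (fun W' => f W' - g W') = fun W' => f W' + (-1) * g W' := by funext W'; ring
  rw [h1, linkLap_add_of_contDiff B hf (contDiff_const.mul hg), linkLap_const_mul']
  ring

end LinkCurve

/-! ## §2. Integration by parts for the Haar product measure -/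

section Haar

/-- `ι` (the embedding `SU(n)^E ↪ M_n(ℂ)^E`) commutes with one-link updates. [folklore] -/
private theorem coeConfig_update' (U : GaugeConfig d L (Matrix.specialUnitaryGroup (Fin n) ℂ))
    (e : Edge d L) (u : Matrix.specialUnitaryGroup (Fin n) ℂ) :
    WilsonFlow.coeConfig (Function.update U e u) =
      Function.update (WilsonFlow.coeConfig U) e (u : Matrix (Fin n) (Fin n) ℂ) := by
  funext e'
  by_cases h : e' = e
  · subst h; simp [WilsonFlow.coeConfig_apply]
  · simp [WilsonFlow.coeConfig_apply, Function.update_of_ne h]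

/-- Left multiplication by the one-link group element `δ_e(u)` of the gauge-field group `SU(n)^E` is the
one-link update `U(e) ↦ u U(e)`. [folklore] -/
theorem mulSingle_mul_eq_update (U : GaugeConfig d L (Matrix.specialUnitaryGroup (Fin n) ℂ))
    (e : Edge d L) (u : Matrix.specialUnitaryGroup (Fin n) ℂ) :
    Pi.mulSingle e u * U = Function.update U e (u * U e) := by
  funext e'
  by_cases h : e' = e
  · subst h; simp
  · simp [Function.update_of_ne h, Pi.mulSingle_eq_of_ne h]

/-- `e^{sY} ∈ SU(n)` for `Y ∈ 𝔰𝔲(n)`. [cite: Luscher2010Trivializing, App. A.1] -/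
private theorem exp_smul_mem_SU' {Y : Matrix (Fin n) (Fin n) ℂ} (hY : Y ∈ suAlgebra n) (s : ℝ) :
    NormedSpace.exp ((s : ℂ) • Y) ∈ Matrix.specialUnitaryGroup (Fin n) ℂ := by
  rw [mem_suAlgebra_iff] at hY
  refine exp_mem_specialUnitaryGroup ?_ ?_
  · rw [Matrix.conjTranspose_smul, hY.1, smul_neg, Complex.star_def, Complex.conj_ofReal]
  · rw [Matrix.trace_smul, hY.2, smul_zero]

variable [NeZero L]

/-- Continuous functions on the compact field manifold are `D[U]`-integrable. [folklore] -/
theorem integrable_trivialMeasure_of_continuous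
    {f : GaugeConfig d L (Matrix.specialUnitaryGroup (Fin n) ℂ) → ℝ} (hf : Continuous f) :
    Integrable f (trivialMeasure (Matrix.specialUnitaryGroup (Fin n) ℂ) d L) := by
  haveI : SecondCountableTopology (Matrix (Fin n) (Fin n) ℂ) :=
    inferInstanceAs (SecondCountableTopology (Fin n → Fin n → ℂ))
  haveI : SecondCountableTopology (Matrix.specialUnitaryGroup (Fin n) ℂ) :=
    Topology.IsEmbedding.subtypeVal.secondCountableTopology
  haveI : IsProbabilityMeasure (trivialMeasure (Matrix.specialUnitaryGroup (Fin n) ℂ) d L) := by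
    unfold trivialMeasure; infer_instance
  exact (BoundedContinuousFunction.mkOfCompact ⟨f, hf⟩).integrable _

/-- **Differentiation under `∫ D[U]` along a link curve**: for smooth `ψ` and `Y ∈ 𝔰𝔲(n)`,
`d/ds ∫ D[U] ψ(e^{sY} U(e), …)|_{s=0} = ∫ D[U] (∂_{e,Y} ψ)(U)` (dominated differentiation: the
`s`-derivative of the integrand is `∂_{e,Y} ψ` evaluated on the compact manifold `SU(n)^E`, hence bounded).
[cite: Luscher2010Trivializing, §4.2 eqs. (4.7)–(4.8)] -/
theorem hasDerivAt_integral_comp_linkCurve {ψ : AmbConfig d L n → ℝ} (hψ : ContDiff ℝ ∞ ψ)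
    (e : Edge d L) {Y : Matrix (Fin n) (Fin n) ℂ} (hY : Y ∈ suAlgebra n) :
    HasDerivAt (fun s : ℝ => ∫ U, ψ (Function.update (WilsonFlow.coeConfig U) e
        (NormedSpace.exp ((s : ℂ) • Y) * WilsonFlow.coeConfig U e))
          ∂(trivialMeasure (Matrix.specialUnitaryGroup (Fin n) ℂ) d L))
      (∫ U, linkDeriv e Y ψ (WilsonFlow.coeConfig U)
        ∂(trivialMeasure (Matrix.specialUnitaryGroup (Fin n) ℂ) d L)) 0 := by
  haveI : SecondCountableTopology (Matrix (Fin n) (Fin n) ℂ) :=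
    inferInstanceAs (SecondCountableTopology (Fin n → Fin n → ℂ))
  haveI : SecondCountableTopology (Matrix.specialUnitaryGroup (Fin n) ℂ) :=
    Topology.IsEmbedding.subtypeVal.secondCountableTopology
  haveI : IsProbabilityMeasure (trivialMeasure (Matrix.specialUnitaryGroup (Fin n) ℂ) d L) := by
    unfold trivialMeasure; infer_instance
  -- the moving point stays on the manifold: `(e^{sY} U(e), …) = ι(U')` with `U' ∈ SU(n)^E`
  have hpt : ∀ (s : ℝ) (U : GaugeConfig d L (Matrix.specialUnitaryGroup (Fin n) ℂ)),
      Function.update (WilsonFlow.coeConfig U) e (NormedSpace.exp ((s : ℂ) • Y) * WilsonFlow.coeConfig U e) =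
        WilsonFlow.coeConfig (Function.update U e
          (⟨NormedSpace.exp ((s : ℂ) • Y), exp_smul_mem_SU' hY s⟩ * U e)) := by
    intro s U
    rw [coeConfig_update', WilsonFlow.coe_mul_SU, WilsonFlow.coeConfig_apply]
  have hpc : ∀ s : ℝ, Continuous fun U : GaugeConfig d L (Matrix.specialUnitaryGroup (Fin n) ℂ) =>
      Function.update (WilsonFlow.coeConfig U) e (NormedSpace.exp ((s : ℂ) • Y) * WilsonFlow.coeConfig U e) :=
    fun s => WilsonFlow.continuous_coeConfig.update e
      (continuous_const.mul ((continuous_apply e).comp WilsonFlow.continuous_coeConfig))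
  have hdc : Continuous fun W : AmbConfig d L n => linkDeriv e Y ψ W :=
    (contDiff_linkDeriv hψ e Y).continuous
  have hFc : ∀ s : ℝ, Continuous fun U : GaugeConfig d L (Matrix.specialUnitaryGroup (Fin n) ℂ) =>
      ψ (Function.update (WilsonFlow.coeConfig U) e
        (NormedSpace.exp ((s : ℂ) • Y) * WilsonFlow.coeConfig U e)) :=
    fun s => hψ.continuous.comp (hpc s)
  have hF'c : Continuous fun U : GaugeConfig d L (Matrix.specialUnitaryGroup (Fin n) ℂ) =>
      linkDeriv e Y ψ (Function.update (WilsonFlow.coeConfig U) e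
        (NormedSpace.exp (((0 : ℝ) : ℂ) • Y) * WilsonFlow.coeConfig U e)) :=
    hdc.comp (hpc 0)
  -- a uniform bound for `∂_{e,Y} ψ` on the compact manifold
  obtain ⟨K, hK⟩ : ∃ K : ℝ, ∀ V : GaugeConfig d L (Matrix.specialUnitaryGroup (Fin n) ℂ),
      ‖linkDeriv e Y ψ (WilsonFlow.coeConfig V)‖ ≤ K := by
    obtain ⟨K, hK⟩ := isCompact_univ.exists_bound_of_continuousOn
      ((hdc.comp WilsonFlow.continuous_coeConfig).continuousOn)
    exact ⟨K, fun V => hK V (Set.mem_univ V)⟩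
  have hD := (hasDerivAt_integral_of_dominated_loc_of_deriv_le
    (μ := trivialMeasure (Matrix.specialUnitaryGroup (Fin n) ℂ) d L) (x₀ := (0 : ℝ))
    (s := Set.univ) (bound := fun _ => K)
    (F := fun (s : ℝ) (U : GaugeConfig d L (Matrix.specialUnitaryGroup (Fin n) ℂ)) =>
      ψ (Function.update (WilsonFlow.coeConfig U) e
        (NormedSpace.exp ((s : ℂ) • Y) * WilsonFlow.coeConfig U e)))
    (F' := fun (s : ℝ) (U : GaugeConfig d L (Matrix.specialUnitaryGroup (Fin n) ℂ)) =>
      linkDeriv e Y ψ (Function.update (WilsonFlow.coeConfig U) e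
        (NormedSpace.exp ((s : ℂ) • Y) * WilsonFlow.coeConfig U e)))
    Filter.univ_mem (Filter.Eventually.of_forall fun s => (hFc s).aestronglyMeasurable)
    (integrable_trivialMeasure_of_continuous (hFc 0)) hF'c.aestronglyMeasurable
    (Filter.Eventually.of_forall fun U s _ => by simp only [hpt]; exact hK _) (integrable_const K)
    (Filter.Eventually.of_forall fun U s _ =>
      hasDerivAt_comp_linkCurve_at (hψ.differentiable (by simp)) (WilsonFlow.coeConfig U) e Y s)).2
  -- at `s = 0` the moving point is `ι(U)` itself
  simp only [Complex.ofReal_zero, zero_smul, NormedSpace.exp_zero, one_mul, Function.update_eq_self] at hD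
  exact hD

/-- **Integration by parts on `SU(n)^E`**: `∫ D[U] (∂_{e,Y} ψ)(U) = 0` for smooth `ψ` and `Y ∈ 𝔰𝔲(n)`.
The Haar product measure is invariant under the left translation `U ↦ δ_e(e^{sY}) U` of the group
`SU(n)^E`, so `s ↦ ∫ D[U] ψ(e^{sY} U(e), …)` is constant; its derivative at `s = 0` is `∫ D[U] ∂_{e,Y} ψ`
(`hasDerivAt_integral_comp_linkCurve`). [cite: Luscher2010Trivializing, §4.2 eqs. (4.7)–(4.9)] -/
theorem integral_linkDeriv_eq_zero {ψ : AmbConfig d L n → ℝ} (hψ : ContDiff ℝ ∞ ψ) (e : Edge d L)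
    {Y : Matrix (Fin n) (Fin n) ℂ} (hY : Y ∈ suAlgebra n) :
    ∫ U, linkDeriv e Y ψ (WilsonFlow.coeConfig U)
      ∂(trivialMeasure (Matrix.specialUnitaryGroup (Fin n) ℂ) d L) = 0 := by
  haveI : SecondCountableTopology (Matrix (Fin n) (Fin n) ℂ) :=
    inferInstanceAs (SecondCountableTopology (Fin n → Fin n → ℂ))
  haveI : SecondCountableTopology (Matrix.specialUnitaryGroup (Fin n) ℂ) :=
    Topology.IsEmbedding.subtypeVal.secondCountableTopology
  haveI : Measure.IsMulLeftInvariant (haarProbability (Matrix.specialUnitaryGroup (Fin n) ℂ)) := by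
    unfold haarProbability; infer_instance
  haveI : Measure.IsMulLeftInvariant (trivialMeasure (Matrix.specialUnitaryGroup (Fin n) ℂ) d L) := by
    unfold trivialMeasure; infer_instance
  -- the link curve through `ι(U)` is the orbit of `U` under the one-parameter subgroup `δ_e(e^{sY})`
  have hcoe : ∀ (s : ℝ) (U : GaugeConfig d L (Matrix.specialUnitaryGroup (Fin n) ℂ)),
      Function.update (WilsonFlow.coeConfig U) e (NormedSpace.exp ((s : ℂ) • Y) * WilsonFlow.coeConfig U e) =
        WilsonFlow.coeConfig
          (Pi.mulSingle e (⟨NormedSpace.exp ((s : ℂ) • Y), exp_smul_mem_SU' hY s⟩ :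
            Matrix.specialUnitaryGroup (Fin n) ℂ) * U) := by
    intro s U
    rw [mulSingle_mul_eq_update, coeConfig_update', WilsonFlow.coe_mul_SU, WilsonFlow.coeConfig_apply]
  -- hence `s ↦ ∫ D[U] ψ(e^{sY} U(e), …)` is constant (left-invariance of `D[U]`)
  have hF : ∀ s : ℝ, ∫ U, ψ (Function.update (WilsonFlow.coeConfig U) e
      (NormedSpace.exp ((s : ℂ) • Y) * WilsonFlow.coeConfig U e))
        ∂(trivialMeasure (Matrix.specialUnitaryGroup (Fin n) ℂ) d L) =
      ∫ U, ψ (WilsonFlow.coeConfig U) ∂(trivialMeasure (Matrix.specialUnitaryGroup (Fin n) ℂ) d L) := by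
    intro s
    simp_rw [hcoe s]
    exact integral_mul_left_eq_self (μ := trivialMeasure (Matrix.specialUnitaryGroup (Fin n) ℂ) d L)
      (fun U => ψ (WilsonFlow.coeConfig U)) _
  have hD := hasDerivAt_integral_comp_linkCurve hψ e hY
  rw [show (fun s : ℝ => ∫ U, ψ (Function.update (WilsonFlow.coeConfig U) e
      (NormedSpace.exp ((s : ℂ) • Y) * WilsonFlow.coeConfig U e))
        ∂(trivialMeasure (Matrix.specialUnitaryGroup (Fin n) ℂ) d L)) =
      fun _ => ∫ U, ψ (WilsonFlow.coeConfig U) ∂(trivialMeasure (Matrix.specialUnitaryGroup (Fin n) ℂ) d L)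
    from funext hF] at hD
  exact hD.unique (hasDerivAt_const _ _)

/-- **Green's identity for `Δ`** (symmetry of `Δ` for the Haar scalar product `(φ,ψ) = ∫ D[U] φ ψ`,
eq. (4.8) at `t = 0`): `∫ D[U] φ Δχ = ∑_{e,a} ∫ D[U] (∂^a_e φ)(∂^a_e χ)` for smooth `φ, χ`.
[cite: Luscher2010Trivializing, §4.2 eqs. (4.6)–(4.8)] -/
theorem integral_mul_linkLap (B : SuBasis n) {φ χ : AmbConfig d L n → ℝ} (hφ : ContDiff ℝ ∞ φ)
    (hχ : ContDiff ℝ ∞ χ) :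
    ∫ U, φ (WilsonFlow.coeConfig U) * linkLap B χ (WilsonFlow.coeConfig U)
        ∂(trivialMeasure (Matrix.specialUnitaryGroup (Fin n) ℂ) d L) =
      ∑ e : Edge d L, ∑ a : B.ι, ∫ U, linkDeriv e (B.T a) φ (WilsonFlow.coeConfig U) *
        linkDeriv e (B.T a) χ (WilsonFlow.coeConfig U)
          ∂(trivialMeasure (Matrix.specialUnitaryGroup (Fin n) ℂ) d L) := by
  set μ := trivialMeasure (Matrix.specialUnitaryGroup (Fin n) ℂ) d L with hμ
  have hc : ∀ {f : AmbConfig d L n → ℝ}, ContDiff ℝ ∞ f →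
      Continuous fun U : GaugeConfig d L (Matrix.specialUnitaryGroup (Fin n) ℂ) =>
        f (WilsonFlow.coeConfig U) :=
    fun hf => hf.continuous.comp WilsonFlow.continuous_coeConfig
  -- one link, one colour: `∫ φ ∂∂χ = -∫ ∂φ ∂χ` (integration by parts of `∂(φ ∂χ)`)
  have key : ∀ (e : Edge d L) (a : B.ι),
      ∫ U, φ (WilsonFlow.coeConfig U) *
          linkDeriv e (B.T a) (linkDeriv e (B.T a) χ) (WilsonFlow.coeConfig U) ∂μ =
        -∫ U, linkDeriv e (B.T a) φ (WilsonFlow.coeConfig U) *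
          linkDeriv e (B.T a) χ (WilsonFlow.coeConfig U) ∂μ := by
    intro e a
    have hdχ : ContDiff ℝ ∞ (linkDeriv e (B.T a) χ) := contDiff_linkDeriv hχ e (B.T a)
    have h0 := integral_linkDeriv_eq_zero (d := d) (L := L) (hφ.mul hdχ) e (B.mem a)
    have hpt : ∀ W, linkDeriv e (B.T a) (fun W' => φ W' * linkDeriv e (B.T a) χ W') W =
        linkDeriv e (B.T a) φ W * linkDeriv e (B.T a) χ W +
          φ W * linkDeriv e (B.T a) (linkDeriv e (B.T a) χ) W := fun W =>
      linkDeriv_mul_of_differentiableAt e (B.T a) (hφ.differentiable (by simp) W)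
        (hdχ.differentiable (by simp) W)
    simp_rw [hpt] at h0
    have hi1 : Integrable (fun U : GaugeConfig d L (Matrix.specialUnitaryGroup (Fin n) ℂ) =>
        linkDeriv e (B.T a) φ (WilsonFlow.coeConfig U) * linkDeriv e (B.T a) χ (WilsonFlow.coeConfig U)) μ :=
      integrable_trivialMeasure_of_continuous ((hc (contDiff_linkDeriv hφ e (B.T a))).mul (hc hdχ))
    have hi2 : Integrable (fun U : GaugeConfig d L (Matrix.specialUnitaryGroup (Fin n) ℂ) =>
        φ (WilsonFlow.coeConfig U) *
          linkDeriv e (B.T a) (linkDeriv e (B.T a) χ) (WilsonFlow.coeConfig U)) μ :=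
      integrable_trivialMeasure_of_continuous ((hc hφ).mul (hc (contDiff_linkDeriv hdχ e (B.T a))))
    rw [integral_add hi1 hi2] at h0
    linarith
  have hlap : ∀ U : GaugeConfig d L (Matrix.specialUnitaryGroup (Fin n) ℂ),
      φ (WilsonFlow.coeConfig U) * linkLap B χ (WilsonFlow.coeConfig U) =
        ∑ e : Edge d L, ∑ a : B.ι, -(φ (WilsonFlow.coeConfig U) *
          linkDeriv e (B.T a) (linkDeriv e (B.T a) χ) (WilsonFlow.coeConfig U)) := by
    intro U
    unfold linkLap
    rw [mul_neg, Finset.mul_sum, ← Finset.sum_neg_distrib]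
    refine Finset.sum_congr rfl fun e _ => ?_
    rw [Finset.mul_sum, ← Finset.sum_neg_distrib]
  have hi3 : ∀ (e : Edge d L) (a : B.ι),
      Integrable (fun U : GaugeConfig d L (Matrix.specialUnitaryGroup (Fin n) ℂ) =>
        -(φ (WilsonFlow.coeConfig U) *
          linkDeriv e (B.T a) (linkDeriv e (B.T a) χ) (WilsonFlow.coeConfig U))) μ := fun e a =>
    integrable_trivialMeasure_of_continuous
      ((hc hφ).mul (hc (contDiff_linkDeriv (contDiff_linkDeriv hχ e (B.T a)) e (B.T a)))).neg
  have hi4 : ∀ e : Edge d L,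
      Integrable (fun U : GaugeConfig d L (Matrix.specialUnitaryGroup (Fin n) ℂ) =>
        ∑ a : B.ι, -(φ (WilsonFlow.coeConfig U) *
          linkDeriv e (B.T a) (linkDeriv e (B.T a) χ) (WilsonFlow.coeConfig U))) μ := fun e =>
    integrable_finsetSum _ fun a _ => hi3 e a
  simp_rw [hlap]
  rw [integral_finsetSum _ fun e _ => hi4 e]
  refine Finset.sum_congr rfl fun e _ => ?_
  rw [integral_finsetSum _ fun a _ => hi3 e a]
  refine Finset.sum_congr rfl fun a _ => ?_
  rw [integral_neg, key, neg_neg]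

/-- **Positivity of `Δ`**: `(φ, Δφ) = ∑_{e,a} ‖∂^a_e φ‖² ≥ 0` (eq. (4.8) at `t = 0`).
[cite: Luscher2010Trivializing, §4.2 eq. (4.8)] -/
theorem integral_mul_linkLap_self_nonneg (B : SuBasis n) {φ : AmbConfig d L n → ℝ}
    (hφ : ContDiff ℝ ∞ φ) :
    0 ≤ ∫ U, φ (WilsonFlow.coeConfig U) * linkLap B φ (WilsonFlow.coeConfig U)
        ∂(trivialMeasure (Matrix.specialUnitaryGroup (Fin n) ℂ) d L) := by
  rw [integral_mul_linkLap B hφ hφ]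
  exact Finset.sum_nonneg fun e _ => Finset.sum_nonneg fun a _ =>
    integral_nonneg fun U => mul_self_nonneg _

/-- **Zero modes of `Δ`** ("the function `φ = 1` is the only zero mode", §4.2 after eq. (4.8); §4.3 after
eq. (4.15)): if `Δφ` is constant on the field manifold `SU(n)^E`, then the constant is `0` and all link
derivatives `∂^a_e φ` vanish on `SU(n)^E`. (Green's identity with `φ = 1` kills the constant; with
`χ = φ` it gives `∑ ‖∂^a_e φ‖²_{L²} = 0`, and a continuous function vanishing `D[U]`-a.e. vanishes, Haar
measure charging open sets.) [cite: Luscher2010Trivializing, §4.2 eqs. (4.8)–(4.9)] -/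
theorem linkDeriv_eq_zero_of_linkLap_eq_const (B : SuBasis n) {φ : AmbConfig d L n → ℝ}
    (hφ : ContDiff ℝ ∞ φ) {κ : ℝ}
    (hκ : ∀ U : GaugeConfig d L (Matrix.specialUnitaryGroup (Fin n) ℂ),
      linkLap B φ (WilsonFlow.coeConfig U) = κ) :
    κ = 0 ∧ ∀ (e : Edge d L) (a : B.ι) (U : GaugeConfig d L (Matrix.specialUnitaryGroup (Fin n) ℂ)),
      linkDeriv e (B.T a) φ (WilsonFlow.coeConfig U) = 0 := by
  haveI : SecondCountableTopology (Matrix (Fin n) (Fin n) ℂ) :=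
    inferInstanceAs (SecondCountableTopology (Fin n → Fin n → ℂ))
  haveI : SecondCountableTopology (Matrix.specialUnitaryGroup (Fin n) ℂ) :=
    Topology.IsEmbedding.subtypeVal.secondCountableTopology
  haveI : Measure.IsHaarMeasure (haarProbability (Matrix.specialUnitaryGroup (Fin n) ℂ)) := by
    unfold haarProbability; infer_instance
  haveI : IsProbabilityMeasure (trivialMeasure (Matrix.specialUnitaryGroup (Fin n) ℂ) d L) := by
    unfold trivialMeasure; infer_instance
  haveI : Measure.IsOpenPosMeasure (trivialMeasure (Matrix.specialUnitaryGroup (Fin n) ℂ) d L) := by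
    unfold trivialMeasure; infer_instance
  set μ := trivialMeasure (Matrix.specialUnitaryGroup (Fin n) ℂ) d L with hμ
  have hconst : ∀ (e : Edge d L) (a : B.ι) (W : AmbConfig d L n),
      linkDeriv e (B.T a) (fun _ : AmbConfig d L n => (1 : ℝ)) W = 0 := by
    intro e a W
    unfold linkDeriv
    exact deriv_const (0 : ℝ) (1 : ℝ)
  -- the constant vanishes: `∫ 1 · Δφ = ∑ ∫ (∂1)(∂φ) = 0`
  have h1 := integral_mul_linkLap B (contDiff_const (c := (1 : ℝ))) hφ
  simp only [hκ, one_mul, hconst, zero_mul, integral_zero, Finset.sum_const_zero, integral_const,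
    smul_eq_mul, probReal_univ] at h1
  have hκ0 : κ = 0 := h1
  refine ⟨hκ0, fun e a U => ?_⟩
  -- the gradient vanishes: `∑ ∫ (∂φ)² = ∫ φ Δφ = 0`
  have h2 := integral_mul_linkLap B hφ hφ
  simp only [hκ, hκ0, mul_zero, integral_zero] at h2
  have hnn : ∀ (e' : Edge d L) (a' : B.ι), 0 ≤ ∫ U, linkDeriv e' (B.T a') φ (WilsonFlow.coeConfig U) *
      linkDeriv e' (B.T a') φ (WilsonFlow.coeConfig U) ∂μ :=
    fun e' a' => integral_nonneg fun U => mul_self_nonneg _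
  have hz : ∫ U, linkDeriv e (B.T a) φ (WilsonFlow.coeConfig U) *
      linkDeriv e (B.T a) φ (WilsonFlow.coeConfig U) ∂μ = 0 := by
    have he := (Finset.sum_eq_zero_iff_of_nonneg fun e' _ =>
      Finset.sum_nonneg fun a' _ => hnn e' a').1 h2.symm e (Finset.mem_univ e)
    exact (Finset.sum_eq_zero_iff_of_nonneg fun a' _ => hnn e a').1 he a (Finset.mem_univ a)
  have hcont : Continuous fun U : GaugeConfig d L (Matrix.specialUnitaryGroup (Fin n) ℂ) =>
      linkDeriv e (B.T a) φ (WilsonFlow.coeConfig U) :=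
    (contDiff_linkDeriv hφ e _).continuous.comp WilsonFlow.continuous_coeConfig
  have hae := (integral_eq_zero_iff_of_nonneg (fun U => mul_self_nonneg _)
    (integrable_trivialMeasure_of_continuous (hcont.mul hcont))).1 hz
  have hfun := (Continuous.ae_eq_iff_eq μ (hcont.mul hcont)
    (continuous_const :
      Continuous fun _ : GaugeConfig d L (Matrix.specialUnitaryGroup (Fin n) ℂ) => (0 : ℝ))).1 hae
  simpa using congrFun hfun U

end Haar

end Summit.Ventures.LatticeQCDFlow.TrivializingMaps
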